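import Literature.Computability.AlgebraicComplexity.BI17GenericPeriodThreeProofs
import HarnessLib

/-!
# Bürgisser–Ikenmeyer 2017, Thm. 4.2: `a(4) = a(5) = a(6) = 1` — PROOFS (invariant degrees)

P. Bürgisser, C. Ikenmeyer, *Fundamental invariants of orbit closures*, J. Algebra **477** (2017)
390–434 = arXiv:1511.02927 [BurgisserIkenmeyer2017], §4.1, Thm. 4.2 (held text
`paper:arxiv-1511.02927` p0015:L51: "We have `a(m) = 1` for `m ≥ 3` and `a(2) = 2`"; its printed
proof, p0015:L55–57, takes the clause `m > 3` from A. M. Popov's theorem on generic trivial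
stabilizers). THEOREMS ONLY; sibling of `BI17GenericPeriodThreeProofs.lean` (the case `m = 3` and
`BI2017_thm_4_2_of_popov`) and of the statement file `BI17FundamentalInvariantTensors.lean`
(val-lit row BI2017-B), whose named fact `BI2017_thm_4_2` is NOT restated and stays a named fact:
after this file it is EQUIVALENT to its clause `m ≥ 7` (`BI2017_thm_4_2_iff_seven_le`). No new
definition, no new named fact.

## What is proved (ours — the print uses Popov's theorem for every `m ≥ 4`)

* `isZariskiGenericTensor_period_eq_one_of_kronRect_pos` — the invariant-degree criterion of the
  sibling file in Kronecker form: if `k_m(δ₁) > 0`, `k_m(δ₂) > 0` (BI eq. (5.2): nonzero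
  `SL_m³`-invariants of degrees `mδ₁`, `mδ₂` on `⊗³ℂ^m`, `genericTensorDegreeMonoid_eq_kronRect`) with
  `gcd(δ₁, δ₂) = 1`, then almost all `w ∈ ⊗³ℂ^m` have stabilizer period `a(w) = 1` — off the
  hypersurface `{F G = 0}` one has `τ^{mδ₁} = τ^{mδ₂} = 1` for the root `τ` of `χ(g)`, `g ∈ stab(w)`,
  hence `χ(g) = τ^m = 1` (`tensorStabilizerPeriod_eq_one_of_sl3Invariants`, BI Lemma 5.1's `ι(t)`).
* `kronRect_five_four_pos : 0 < k_5(4)`, `kronRect_six_four_pos : 0 < k_6(4)` — KERNEL certificates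
  by the tree's verified Murnaghan–Nakayama evaluator (`MNEval.kronSum`, `S_20` and `S_24`; BI
  Ex. 5.6: "`E'(5) = E'(6) = {0,3,4,5,6,…}`").
* `BI2017_thm_4_2_four/_five/_six` — **`a(4) = a(5) = a(6) = 1` PROVED**, from the coprime pairs
  `(δ₁, δ₂) = (2, 3)` (`k_4(2) = 1`, `k_4(3) > 0`, tree), `(3, 4)` (`k_5(3) > 0` tree, `k_5(4) > 0`
  here), `(3, 4)` (`k_6(3) > 0` tree, `k_6(4) > 0` here).
* `BI2017_thm_4_2_of_le_six` (all `3 ≤ m ≤ 6`) and `BI2017_thm_4_2_iff_seven_le`: the named fact is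
  equivalent to its clause `m ≥ 7`.

Why we stop at `m = 6` (honest sizing): for `m = 7` the coprime pair needs `k_7(5) > 0` (`S_35`,
`14883` classes on a `7`-row shape), for `m = 8, 9` it needs `k_8(4)`, `k_9(4)` (`S_32`, `S_36` on
`8`-, `9`-row shapes) — beyond one kernel `decide` of the evaluator; and an all-`m` invariant route
would need the rectangular Kronecker positivity `B_{3,k}` of Amanov–Yeliussizov (IMRN 2022,
arXiv:2202.11059, §1.2), which is conjectural for general `k`. So for `m ≥ 7` Popov's theorem
(`BI2017_popov_trivialStabilizer`, not held, not proved) remains the only source, exactly as in print.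

Honest framing: typed-literature proofs for the cell `val-lit` (LADDER-VALIANT V3, a known-results
layer); nothing here bears on VP versus VNP.

## References

* [BurgisserIkenmeyer2017] P. Bürgisser, C. Ikenmeyer, *Fundamental invariants of orbit closures*,
  J. Algebra 477 (2017) 390–434; arXiv:1511.02927, §4.1 Thm. 4.2, §5 eq. (5.2), Ex. 5.6.
* A. Amanov, D. Yeliussizov, *Fundamental invariants of tensors, Latin hypercubes, and rectangular
  Kronecker coefficients*, IMRN 2023; arXiv:2202.11059, §1.2 (statements `A_{d,k}`, `B_{d,k}`).
* A. M. Popov, Trudy Moskov. Mat. Obshch. 50 (1987) 209–248, Thm. 2 (as quoted in BI 2017).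
-/

noncomputable section

open MvPolynomial Matrix
open _root_.Literature.NumberTheory.DiophantineGeometry
open _root_.Literature.RepresentationTheory.FiniteGroups.MNEval (kronSum kroneckerCoeff_pos_iff_kronSum_pos)

namespace Literature.Computability.AlgebraicComplexity

/-! ### The criterion in Kronecker form -/

section Criterion

/-- **Period one from two coprime invariant degrees, Kronecker form.** If `k_m(δ₁) > 0` and
`k_m(δ₂) > 0` with `gcd(δ₁, δ₂) = 1` (`m ≥ 1`), then almost all `w ∈ ⊗³ℂ^m` have stabilizer period
`a(w) = 1`: there are nonzero homogeneous `SL_m³`-invariants `F`, `G` of degrees `mδ₁`, `mδ₂`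
(eq. (5.2)), and off `{F G = 0}` the sibling criterion `tensorStabilizerPeriod_eq_one_of_sl3Invariants`
applies with `gcd(mδ₁, mδ₂) = m`. [cite: BurgisserIkenmeyer2017, Thm. 4.2 and §5 eq. (5.2)] -/
theorem isZariskiGenericTensor_period_eq_one_of_kronRect_pos {m δ₁ δ₂ : ℕ} (hm : 0 < m)
    (h₁ : 0 < kronRect ℂ m δ₁) (h₂ : 0 < kronRect ℂ m δ₂) (hcop : Nat.Coprime δ₁ δ₂) :
    IsZariskiGenericTensor fun w : Fin m → Fin m → Fin m → ℂ => tensorStabilizerPeriod w = 1 := by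
  have hd₁ : m * δ₁ ∈ genericTensorDegreeMonoid (Fin m) ℂ := by
    rw [genericTensorDegreeMonoid_eq_kronRect]
    exact ⟨δ₁, rfl, h₁⟩
  have hd₂ : m * δ₂ ∈ genericTensorDegreeMonoid (Fin m) ℂ := by
    rw [genericTensorDegreeMonoid_eq_kronRect]
    exact ⟨δ₂, rfl, h₂⟩
  obtain ⟨F, hFh, hFi, hF0⟩ := hd₁
  obtain ⟨G, hGh, hGi, hG0⟩ := hd₂
  haveI : Nonempty (Fin m) := ⟨⟨0, hm⟩⟩
  refine ⟨F * G, mul_ne_zero hF0 hG0, fun w hw => ?_⟩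
  rw [map_mul] at hw
  have hgcd : Nat.gcd (m * δ₁) (m * δ₂) ∣ Fintype.card (Fin m) := by
    rw [Fintype.card_fin, Nat.gcd_mul_left, hcop, mul_one]
  exact tensorStabilizerPeriod_eq_one_of_sl3Invariants w hFh hFi (left_ne_zero_of_mul hw)
    hGh hGi (right_ne_zero_of_mul hw) hgcd

end Criterion

/-! ### Two more kernel certificates: `k_5(4) > 0`, `k_6(4) > 0` -/

section Certificates

/-- **`k_5(4) > 0`** (BI Ex. 5.6: `4 ∈ E'(5) = {0,3,4,5,6,…}`), certified in the kernel by the tree's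
Murnaghan–Nakayama evaluator (`S_20`). [cite: BurgisserIkenmeyer2017, Ex. 5.6] -/
theorem kronRect_five_four_pos : 0 < kronRect ℂ 5 4 := by
  rw [kronRect, kroneckerCoeff_pos_iff_kronSum_pos, Nat.Partition.sortedParts_rectangle 5 4 (by norm_num)]
  set_option maxHeartbeats 100000000 in
  set_option maxRecDepth 100000 in
  decide +kernel

/-- **`k_6(4) > 0`** (BI Ex. 5.6: `4 ∈ E'(6) = {0,3,4,5,6,…}`), certified in the kernel by the tree's
Murnaghan–Nakayama evaluator (`S_24`, under a minute of kernel time). [cite: BurgisserIkenmeyer2017, Ex. 5.6] -/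
theorem kronRect_six_four_pos : 0 < kronRect ℂ 6 4 := by
  rw [kronRect, kroneckerCoeff_pos_iff_kronSum_pos, Nat.Partition.sortedParts_rectangle 6 4 (by norm_num)]
  set_option maxHeartbeats 100000000 in
  set_option maxRecDepth 100000 in
  decide +kernel

end Certificates

/-! ### Thm. 4.2 for `m = 4, 5, 6`, and the named fact reduced to its clause `m ≥ 7` -/

section ThmFourTwo

/-- **BI 2017, Thm. 4.2, case `m = 4`: `a(4) = 1` — PROVED.** Almost all `w ∈ ⊗³ℂ⁴` have stabilizer
period `1`: coprime exponents `2, 3 ∈ E'(4)` (`k_4(2) = 1`, `k_4(3) > 0`, i.e. nonzero invariants of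
degrees `8` and `12`). [cite: BurgisserIkenmeyer2017, Thm. 4.2] -/
theorem BI2017_thm_4_2_four :
    IsZariskiGenericTensor fun w : Fin 4 → Fin 4 → Fin 4 → ℂ => tensorStabilizerPeriod w = 1 :=
  isZariskiGenericTensor_period_eq_one_of_kronRect_pos (by norm_num)
    (kronRect_four_pos (δ := 2) (by norm_num)) kronRect_four_three_pos (by norm_num)

/-- **BI 2017, Thm. 4.2, case `m = 5`: `a(5) = 1` — PROVED.** Coprime exponents `3, 4 ∈ E'(5)`
(`k_5(3) > 0`, `k_5(4) > 0`: nonzero invariants of degrees `15` and `20`).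
[cite: BurgisserIkenmeyer2017, Thm. 4.2] -/
theorem BI2017_thm_4_2_five :
    IsZariskiGenericTensor fun w : Fin 5 → Fin 5 → Fin 5 → ℂ => tensorStabilizerPeriod w = 1 :=
  isZariskiGenericTensor_period_eq_one_of_kronRect_pos (by norm_num)
    kronRect_five_three_pos kronRect_five_four_pos (by norm_num)

/-- **BI 2017, Thm. 4.2, case `m = 6`: `a(6) = 1` — PROVED.** Coprime exponents `3, 4 ∈ E'(6)`
(`k_6(3) > 0`, `k_6(4) > 0`: nonzero invariants of degrees `18` and `24`).
[cite: BurgisserIkenmeyer2017, Thm. 4.2] -/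
theorem BI2017_thm_4_2_six :
    IsZariskiGenericTensor fun w : Fin 6 → Fin 6 → Fin 6 → ℂ => tensorStabilizerPeriod w = 1 :=
  isZariskiGenericTensor_period_eq_one_of_kronRect_pos (by norm_num)
    kronRect_six_three_pos kronRect_six_four_pos (by norm_num)

/-- **BI 2017, Thm. 4.2 for `3 ≤ m ≤ 6` — PROVED** (cases `m = 3` of the sibling file and `4, 5, 6`
above). [cite: BurgisserIkenmeyer2017, Thm. 4.2] -/
theorem BI2017_thm_4_2_of_le_six (m : ℕ) (h3 : 3 ≤ m) (h6 : m ≤ 6) :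
    IsZariskiGenericTensor fun w : Fin m → Fin m → Fin m → ℂ => tensorStabilizerPeriod w = 1 := by
  interval_cases m
  · exact BI2017_thm_4_2_three
  · exact BI2017_thm_4_2_four
  · exact BI2017_thm_4_2_five
  · exact BI2017_thm_4_2_six

/-- **BI 2017, Thm. 4.2 is equivalent to its clause `m ≥ 7`**: the clauses `m = 2` (period `2`,
`BI2017_thm_4_2_two`) and `3 ≤ m ≤ 6` (period `1`) are theorems of the tree, so the named fact
`BI2017_thm_4_2` says exactly "`a(m) = 1` for almost all `w ∈ ⊗³ℂ^m`, `m ≥ 7`" — the range where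
the printed proof's only input is Popov's theorem (`BI2017_thm_4_2_of_popov`).
[cite: BurgisserIkenmeyer2017, Thm. 4.2] -/
theorem BI2017_thm_4_2_iff_seven_le :
    BI2017_thm_4_2 ↔ ∀ m : ℕ, 7 ≤ m →
      IsZariskiGenericTensor fun w : Fin m → Fin m → Fin m → ℂ => tensorStabilizerPeriod w = 1 := by
  rw [BI2017_thm_4_2_iff_four_le]
  refine ⟨fun h m hm => h m (le_trans (by norm_num) hm), fun h m hm => ?_⟩
  rcases Nat.lt_or_ge m 7 with hlt | hge
  · exact BI2017_thm_4_2_of_le_six m (le_trans (by norm_num) hm) (by omega)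
  · exact h m hge

end ThmFourTwo

end Literature.Computability.AlgebraicComplexity
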